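import Literature.Probability.LatticeModels.WeightedCurrentsSwitching
import Literature.Probability.LatticeModels.CurrentInsertion
import Mathlib.Combinatorics.SimpleGraph.DeleteEdges
import Mathlib.Analysis.SpecialFunctions.Trigonometric.Series
import HarnessLib

/-!
# Current sums with a dead bond set: edge decomposition, monotonicity and supermodularity

Topic `Literature/Probability/LatticeModels`, namespace `Literature.Probability.LatticeModels`
(dot-notation extensions in `….Current`). Infrastructure for the proof of Aizenman 1982,
Proposition 12.1 (`aizenman_wickDeviation_le_finite`, `AizenmanWickBound.lean`), whose random-walk
expansion (M. Aizenman, *Geometric analysis of `φ⁴` fields and Ising models*, Comm. Math. Phys. **86**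
(1982), §9) compares the free Ising model on a finite graph `G` with the models obtained by *deleting
the bonds used by a walk* (the factor `z(B(ω)) = Z_{G∖B}/Z_G` of the walk weights `ρ(ω)`, Prop. 9.2,
and its monotonicity under further deletions, Lemmas 9.2–9.3).

For a finite set `D` of bonds of `G` ("dead bonds") and a source set `S` we consider, in `ℝ≥0∞` and
for `β ≥ 0`,

`Z_D(S) = ∑_{n : ∂n = S, n ≡ 0 on D} w_β(n)` (`Current.dsum β D S`),

the current sum of the graph `G` with the bonds of `D` removed, written with currents of `G` itself
(so that no change of edge type is ever needed). Main statements: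

* `Current.dsum_eq_cosh_mul_add_sinh_mul` — deleting one more bond `e = {u,v} ∉ D`:
  `Z_D(S) = cosh β · Z_{D+e}(S) + sinh β · Z_{D+e}(S ∆ {u,v})` (split the value of `n` on `e` by parity);
* `Current.dsum_pair_mul_dsum_le` — Griffiths' second inequality for the diluted sums,
  `Z_D({x}∆{y}) Z_D(S) ≤ Z_D(∅) Z_D(S ∆ {x} ∆ {y})`, from the switching lemma of the tree
  (`Current.etsum_switching_univ`) applied with `F = 𝟙[n₁ + n₂ ≡ 0 on D]`;
* `Current.dsum_pair_mul_dsum_empty_le` — monotonicity of the two-point ratio under dilution,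
  `Z_{D'}({u}∆{v}) Z_D(∅) ≤ Z_D({u}∆{v}) Z_{D'}(∅)` for `D ⊆ D'`;
* `Current.dsum_empty_supermodular` — **supermodularity of the free energy in the bond set**:
  `Z_{D ∪ U}(∅) · Z_∅(∅) ≥ Z_D(∅) · Z_U(∅)`, i.e. `z(B ∪ B') ≥ z(B) z(B')` for the deletion factors
  (Aizenman 1982, Lemma 9.3, the inequality `ρ_{B^c}(ω) ≥ ρ(ω)`).

## References

* M. Aizenman, Comm. Math. Phys. 86 (1982) 1–48, §9 (Prop. 9.2, Lemmas 9.2–9.3) [AizenmanCMP1982].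
* R. B. Griffiths, C. A. Hurst, S. Sherman, J. Math. Phys. 11 (1970) 790 (switching lemma) — through
  `WeightedCurrentsSwitching.lean`.

## Mathlib

`SimpleGraph.deleteEdges`, `SimpleGraph.edgeSet_deleteEdges`, `Real.hasSum_cosh`, `Real.hasSum_sinh`,
`HasSum.even_add_odd`, `ENNReal.ofReal_tsum_of_nonneg`, `ENNReal.tsum_prod`, `Equiv.tsum_eq`,
`tsum_subtype`, `ENNReal.mul_le_mul_iff_left`; tree: `Current.splitAt`, `Current.weight_update`,
`Current.sources_update_succ` (`CurrentInsertion`), `Current.etsum_switching_univ`,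
`Current.add_mem_connIn_of_sources_eq` (`CurrentSwitching`, `WeightedCurrentsSwitching`).
-/

noncomputable section

open Finset
open scoped symmDiff ENNReal Nat

namespace Literature.Probability.LatticeModels

variable {V : Type*} [Fintype V] [DecidableEq V] {G : SimpleGraph V} [DecidableRel G.Adj]

namespace Current

/-! ### Currents vanishing on a bond set; the diluted current sums -/

/-- `n` vanishes on the dead bonds `D` (it is a current of the graph with the bonds of `D` removed). [folklore] -/
def Vanishes (D : Finset G.edgeFinset) (n : Current G) : Prop := ∀ e ∈ D, n e = 0

/-- Vanishing on a finite bond set is decidable. [folklore] -/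
instance instDecidableVanishes (D : Finset G.edgeFinset) (n : Current G) : Decidable (Vanishes D n) := by
  unfold Vanishes; infer_instance

omit [DecidableEq V] in
/-- Every current vanishes on the empty dead set. [folklore] -/
@[simp] theorem vanishes_empty (n : Current G) : Vanishes ∅ n := fun _ h => absurd h (notMem_empty _)

omit [DecidableEq V] in
/-- The zero current vanishes everywhere. [folklore] -/
@[simp] theorem vanishes_zero (D : Finset G.edgeFinset) : Vanishes D (0 : Current G) := fun _ _ => rfl

/-- Vanishing on a union. [folklore] -/
theorem vanishes_union {D D' : Finset G.edgeFinset} {n : Current G} :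
    Vanishes (D ∪ D') n ↔ Vanishes D n ∧ Vanishes D' n := by
  simp only [Vanishes, mem_union]
  exact ⟨fun h => ⟨fun e he => h e (Or.inl he), fun e he => h e (Or.inr he)⟩,
    fun h e he => he.elim (h.1 e) (h.2 e)⟩

/-- Vanishing on `insert e D`. [folklore] -/
theorem vanishes_insert {D : Finset G.edgeFinset} {e : G.edgeFinset} {n : Current G} :
    Vanishes (insert e D) n ↔ n e = 0 ∧ Vanishes D n := by
  simp only [Vanishes, mem_insert, forall_eq_or_imp]

omit [DecidableEq V] in
/-- Vanishing is antitone in the dead set. [folklore] -/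
theorem Vanishes.mono {D D' : Finset G.edgeFinset} (h : D ⊆ D') {n : Current G} (hn : Vanishes D' n) :
    Vanishes D n := fun e he => hn e (h he)

omit [DecidableEq V] in
/-- A sum of currents vanishes on `D` iff both do. [folklore] -/
theorem vanishes_add {D : Finset G.edgeFinset} {n m : Current G} :
    Vanishes D (n + m) ↔ Vanishes D n ∧ Vanishes D m := by
  simp only [Vanishes, Pi.add_apply, Nat.add_eq_zero_iff]
  exact ⟨fun h => ⟨fun e he => (h e he).1, fun e he => (h e he).2⟩, fun h e he => ⟨h.1 e he, h.2 e he⟩⟩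

/-- **The diluted current sum** `Z_D(S) = ∑_{∂n = S, n ≡ 0 on D} w_β(n)` (in `ℝ≥0∞`): the current sum
with sources `S` of the graph `G` with the bonds of `D` deleted (Aizenman 1982, §9: the systems
"`B^c`" obtained by removing the bonds of a walk). [cite: AizenmanCMP1982, §9 (Prop. 9.2, the factor z(B))] -/
def dsum (β : ℝ) (D : Finset G.edgeFinset) (S : Finset V) : ℝ≥0∞ :=
  ∑' n : Current G, if n.sources = S ∧ Vanishes D n then n.eweight (fun _ => β) else 0

/-- With no dead bonds the diluted sum is the tree's `ecurrentSum`. [folklore] -/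
theorem dsum_empty_left (β : ℝ) (S : Finset V) : dsum (G := G) β ∅ S = ecurrentSum (fun _ : G.edgeFinset => β) S := by
  unfold dsum ecurrentSum
  exact tsum_congr fun n => by simp

/-- The diluted sum is antitone in the dead set. [folklore] -/
theorem dsum_anti (β : ℝ) {D D' : Finset G.edgeFinset} (h : D ⊆ D') (S : Finset V) :
    dsum β D' S ≤ dsum β D S := by
  unfold dsum
  refine ENNReal.tsum_le_tsum fun n => ?_
  by_cases hn : n.sources = S ∧ Vanishes D' n
  · rw [if_pos hn, if_pos ⟨hn.1, hn.2.mono h⟩]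
  · rw [if_neg hn]; exact bot_le

/-- The diluted sum is finite. [folklore] -/
theorem dsum_ne_top {β : ℝ} (hβ : 0 ≤ β) (D : Finset G.edgeFinset) (S : Finset V) : dsum (G := G) β D S ≠ ∞ := by
  classical
  exact tsum_ite_eweight_ne_top (fun _ => hβ) _

/-- The zero current gives `1 ≤ Z_D(∅)`. [folklore] -/
theorem one_le_dsum_empty (β : ℝ) (D : Finset G.edgeFinset) : 1 ≤ dsum (G := G) β D ∅ := by
  unfold dsum
  refine le_trans (le_of_eq ?_) (ENNReal.le_tsum (0 : Current G))
  rw [if_pos ⟨sources_zero, vanishes_zero D⟩, eweight_zero]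

/-- `Z_D(∅) ≠ 0`. [folklore] -/
theorem dsum_empty_ne_zero (β : ℝ) (D : Finset G.edgeFinset) : dsum (G := G) β D ∅ ≠ 0 :=
  (lt_of_lt_of_le zero_lt_one (one_le_dsum_empty β D)).ne'

/-! ### Parity series -/

/-- `∑_{k even} β^k/k! = cosh β` in `ℝ≥0∞`. [folklore] -/
theorem tsum_ite_even_eq_cosh (β : ℝ) :
    ∑' k : ℕ, (if Even k then ENNReal.ofReal (β ^ k / k !) else 0) = ENNReal.ofReal (Real.cosh β) := by
  set f : ℕ → ℝ := fun k => if Even k then β ^ k / k ! else 0 with hf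
  have hf0 : ∀ k, 0 ≤ f k := fun k => by
    simp only [hf]
    split_ifs with h
    · exact div_nonneg (Even.pow_nonneg h β) (Nat.cast_nonneg _)
    · exact le_rfl
  have hsum : HasSum f (Real.cosh β + 0) := by
    refine HasSum.even_add_odd ?_ ?_
    · have : (fun k => f (2 * k)) = fun n => β ^ (2 * n) / ↑(2 * n)! := by
        funext k; simp [hf]
      rw [this]; exact Real.hasSum_cosh β
    · have : (fun k => f (2 * k + 1)) = fun _ => 0 := by
        funext k; simp [hf]
      rw [this]; exact hasSum_zero
  rw [add_zero] at hsum
  have h1 : (fun k : ℕ => (if Even k then ENNReal.ofReal (β ^ k / k !) else 0)) = fun k => ENNReal.ofReal (f k) := by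
    funext k; simp only [hf]; split_ifs <;> simp
  rw [h1, ← ENNReal.ofReal_tsum_of_nonneg hf0 hsum.summable, hsum.tsum_eq]

/-- `∑_{k odd} β^k/k! = sinh β` in `ℝ≥0∞` (`β ≥ 0`). [folklore] -/
theorem tsum_ite_odd_eq_sinh {β : ℝ} (hβ : 0 ≤ β) :
    ∑' k : ℕ, (if Odd k then ENNReal.ofReal (β ^ k / k !) else 0) = ENNReal.ofReal (Real.sinh β) := by
  set f : ℕ → ℝ := fun k => if Odd k then β ^ k / k ! else 0 with hf
  have hf0 : ∀ k, 0 ≤ f k := fun k => by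
    simp only [hf]
    split_ifs
    · exact div_nonneg (pow_nonneg hβ _) (Nat.cast_nonneg _)
    · exact le_rfl
  have hsum : HasSum f (0 + Real.sinh β) := by
    refine HasSum.even_add_odd ?_ ?_
    · have : (fun k => f (2 * k)) = fun _ => 0 := by
        funext k; simp [hf, Nat.not_odd_iff_even]
      rw [this]; exact hasSum_zero
    · have : (fun k => f (2 * k + 1)) = fun n => β ^ (2 * n + 1) / ↑(2 * n + 1)! := by
        funext k; simp [hf]
      rw [this]; exact Real.hasSum_sinh β
  rw [zero_add] at hsum
  have h1 : (fun k : ℕ => (if Odd k then ENNReal.ofReal (β ^ k / k !) else 0)) = fun k => ENNReal.ofReal (f k) := by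
    funext k; simp only [hf]; split_ifs <;> simp
  rw [h1, ← ENNReal.ofReal_tsum_of_nonneg hf0 hsum.summable, hsum.tsum_eq]

/-! ### Deleting one more bond: the parity decomposition -/

/-- Sources after resetting the value on an edge `{a,b}` (from an empty edge): `∂(r[e ↦ k]) = ∂r ∆ 𝟙[k odd]{a,b}`. [folklore] -/
theorem sources_update_eq (e₀ : G.edgeFinset) {a b : V} (hab : (e₀ : Sym2 V) = s(a, b)) {r : Current G}
    (hr : r e₀ = 0) (k : ℕ) :
    sources (Function.update r e₀ k) = if Odd k then r.sources ∆ {a, b} else r.sources := by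
  induction k with
  | zero =>
    rw [if_neg (by decide)]
    congr 1
    exact Function.update_eq_self_iff.mpr hr.symm
  | succ k ih =>
    rw [sources_update_succ e₀ hab, ih]
    by_cases hk : Odd k
    · rw [if_pos hk, if_neg (fun h => (Nat.not_even_iff_odd.mpr hk) (by simpa [Nat.odd_add_one] using h)),
        symmDiff_assoc, symmDiff_self, symmDiff_bot]
    · rw [if_neg hk, if_pos (by simpa [Nat.odd_add_one, Nat.not_odd_iff_even] using hk)]

/-- The `ℝ≥0∞` weight after resetting the value on an empty edge: `w(r[e ↦ k]) = β^k/k! · w(r)` (`β ≥ 0`). [folklore] -/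
theorem eweight_update {β : ℝ} (hβ : 0 ≤ β) (e₀ : G.edgeFinset) {r : Current G} (hr : r e₀ = 0) (k : ℕ) :
    eweight (fun _ => β) (Function.update r e₀ k) = ENNReal.ofReal (β ^ k / k !) * r.eweight (fun _ => β) := by
  rw [eweight, eweight, ← weight_eq_wweight, ← weight_eq_wweight, weight_update e₀ hr k β,
    ENNReal.ofReal_mul (div_nonneg (pow_nonneg hβ _) (Nat.cast_nonneg _))]

/-- `A ∆ P = S ↔ A = S ∆ P`. [folklore] -/
theorem symmDiff_eq_iff_eq_symmDiff (A P S : Finset V) : A ∆ P = S ↔ A = S ∆ P := by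
  constructor
  · intro h; rw [← h, symmDiff_assoc, symmDiff_self, symmDiff_bot]
  · intro h; rw [h, symmDiff_assoc, symmDiff_self, symmDiff_bot]

/-- **Deleting one more bond** (the parity decomposition along an edge `e = {a,b} ∉ D`):
`Z_D(S) = cosh β · Z_{D ∪ {e}}(S) + sinh β · Z_{D ∪ {e}}(S ∆ {a,b})` — split `n` into its value `k` on
`e` and the rest; even `k` contribute `cosh β`, odd `k` contribute `sinh β` and shift the sources by
`{a,b}`. [folklore] -/
theorem dsum_eq_cosh_mul_add_sinh_mul {β : ℝ} (hβ : 0 ≤ β) {D : Finset G.edgeFinset} {e₀ : G.edgeFinset}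
    (he₀ : e₀ ∉ D) {a b : V} (hab : (e₀ : Sym2 V) = s(a, b)) (S : Finset V) :
    dsum β D S = ENNReal.ofReal (Real.cosh β) * dsum β (insert e₀ D) S +
      ENNReal.ofReal (Real.sinh β) * dsum β (insert e₀ D) (S ∆ {a, b}) := by
  classical
  set K : G.edgeFinset → ℝ := fun _ => β with hK
  set f : Current G → ℝ≥0∞ := fun n => if n.sources = S ∧ Vanishes D n then n.eweight K else 0 with hf
  -- reindex by the value on `e₀` and the rest
  have h1 : dsum β D S = ∑' q : ℕ × {r : Current G // r e₀ = 0}, f (Function.update q.2.1 e₀ q.1) := by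
    unfold dsum
    rw [← Equiv.tsum_eq (splitAt e₀).symm]
    rfl
  -- the summand after splitting
  have h2 : ∀ (k : ℕ) (r : {r : Current G // r e₀ = 0}), f (Function.update r.1 e₀ k) =
      ENNReal.ofReal (β ^ k / k !) *
        (if r.1.sources = (if Odd k then S ∆ {a, b} else S) ∧ Vanishes D r.1 then r.1.eweight K else 0) := by
    intro k r
    have hvan : Vanishes D (Function.update r.1 e₀ k) ↔ Vanishes D r.1 := by
      refine forall₂_congr fun e he => ?_
      rw [Function.update_of_ne (ne_of_mem_of_not_mem he he₀)]
    have hsrc : sources (Function.update r.1 e₀ k) = S ↔ r.1.sources = (if Odd k then S ∆ {a, b} else S) := by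
      rw [sources_update_eq e₀ hab r.2 k]
      by_cases hk : Odd k
      · rw [if_pos hk, if_pos hk]; exact symmDiff_eq_iff_eq_symmDiff _ _ _
      · rw [if_neg hk, if_neg hk]
    simp only [hf, hvan, hsrc]
    by_cases h : (r.1).sources = (if Odd k then S ∆ {a, b} else S) ∧ Vanishes D r.1
    · rw [if_pos h, if_pos h, eweight_update hβ e₀ r.2 k]
    · rw [if_neg h, if_neg h, mul_zero]
  -- the inner sums are diluted sums with `e₀` dead as well
  have h3 : ∀ S' : Finset V, ∑' r : {r : Current G // r e₀ = 0},
      (if r.1.sources = S' ∧ Vanishes D r.1 then r.1.eweight K else 0) = dsum β (insert e₀ D) S' := by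
    intro S'
    set g : Current G → ℝ≥0∞ := fun r => if r.sources = S' ∧ Vanishes D r then r.eweight K else 0 with hg
    calc (∑' r : {r : Current G // r e₀ = 0}, g r.1)
        = ∑' r : Current G, ({r : Current G | r e₀ = 0} : Set (Current G)).indicator g r :=
          tsum_subtype ({r : Current G | r e₀ = 0} : Set (Current G)) g
      _ = dsum β (insert e₀ D) S' := by
          unfold dsum
          refine tsum_congr fun r => ?_
          simp only [Set.indicator_apply, Set.mem_setOf_eq, vanishes_insert, hg]
          by_cases hr : r e₀ = 0
          · simp [hr, hK]
          · rw [if_neg hr, if_neg (fun h => hr h.2.1)]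
  have hprod : (∑' q : ℕ × {r : Current G // r e₀ = 0}, f (Function.update q.2.1 e₀ q.1)) =
      ∑' k : ℕ, ∑' r : {r : Current G // r e₀ = 0}, f (Function.update r.1 e₀ k) :=
    ENNReal.tsum_prod (f := fun k (r : {r : Current G // r e₀ = 0}) => f (Function.update r.1 e₀ k))
  rw [h1, hprod]
  simp_rw [h2, ENNReal.tsum_mul_left, h3]
  -- split the sum over `k` by parity
  have h4 : ∀ k : ℕ, ENNReal.ofReal (β ^ k / k !) * dsum β (insert e₀ D) (if Odd k then S ∆ {a, b} else S) =
      (if Even k then ENNReal.ofReal (β ^ k / k !) else 0) * dsum β (insert e₀ D) S +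
        (if Odd k then ENNReal.ofReal (β ^ k / k !) else 0) * dsum β (insert e₀ D) (S ∆ {a, b}) := by
    intro k
    rcases Nat.even_or_odd k with hk | hk
    · rw [if_neg (Nat.not_odd_iff_even.mpr hk), if_pos hk, if_neg (Nat.not_odd_iff_even.mpr hk), zero_mul, add_zero]
    · rw [if_pos hk, if_neg (Nat.not_even_iff_odd.mpr hk), if_pos hk, zero_mul, zero_add]
  simp_rw [h4]
  rw [ENNReal.tsum_add, ENNReal.tsum_mul_right, ENNReal.tsum_mul_right, tsum_ite_even_eq_cosh,
    tsum_ite_odd_eq_sinh hβ]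

/-! ### The graph with the dead bonds deleted; Griffiths II for diluted sums -/

/-- The graph `G` with the dead bonds `D` deleted. [folklore] -/
def deadGraph (G : SimpleGraph V) [DecidableRel G.Adj] (D : Finset G.edgeFinset) : SimpleGraph V :=
  G.deleteEdges (↑(D.image fun e : G.edgeFinset => (e : Sym2 V)) : Set (Sym2 V))

/-- Adjacency in `deadGraph` is decidable. [folklore] -/
instance instDecidableRelDeadGraphAdj (D : Finset G.edgeFinset) : DecidableRel (deadGraph G D).Adj := by
  unfold deadGraph; infer_instance

/-- A current is supported on `deadGraph G D` iff it vanishes on `D`. [folklore] -/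
theorem isSupp_deadGraph_iff (D : Finset G.edgeFinset) (n : Current G) :
    IsSupp (deadGraph G D) n ↔ Vanishes D n := by
  have key : ∀ e : G.edgeFinset, (e : Sym2 V) ∉ (deadGraph G D).edgeFinset ↔ e ∈ D := by
    intro e
    rw [SimpleGraph.mem_edgeFinset, deadGraph, SimpleGraph.edgeSet_deleteEdges, Set.mem_sdiff, not_and, not_not]
    have he : (e : Sym2 V) ∈ G.edgeSet := SimpleGraph.mem_edgeFinset.mp e.2
    simp only [he, forall_true_left, Finset.coe_image, Set.mem_image, Finset.mem_coe]
    constructor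
    · rintro ⟨e', he', h⟩
      rwa [← Subtype.ext h]
    · intro h; exact ⟨e, h, rfl⟩
  simp only [IsSupp, Vanishes, key]

/-- **Griffiths' second inequality for diluted sums** (from the switching lemma with
`F = 𝟙[n₁ + n₂ ≡ 0 on D]`): `Z_D({x}∆{y}) · Z_D(S) ≤ Z_D(∅) · Z_D(S ∆ ({x}∆{y}))`, i.e.
`⟨σ_xσ_y⟩⟨σ_S⟩ ≤ ⟨σ_xσ_yσ_S⟩` in the diluted model. [cite: GriffithsHurstSherman1970, switching lemma (GKS II)] -/
theorem dsum_pair_mul_dsum_le {β : ℝ} (hβ : 0 ≤ β) (D : Finset G.edgeFinset) (S : Finset V) (x y : V) :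
    dsum β D ({x} ∆ {y}) * dsum β D S ≤ dsum β D ∅ * dsum β D (S ∆ ({x} ∆ {y})) := by
  classical
  set K : G.edgeFinset → ℝ := fun _ => β with hK
  have hK0 : ∀ e, 0 ≤ K e := fun _ => hβ
  have hsw := etsum_switching_univ (G := G) (deadGraph G D) hK0 ({x} ∆ {y}) S x y
    (fun m => if Vanishes D m then 1 else 0)
  rw [symmDiff_self, Finset.bot_eq_empty] at hsw
  -- the left-hand side of the switching identity is the product of the two diluted sums
  have hL : dsum β D ({x} ∆ {y}) * dsum β D S = ∑' p : Current G × Current G,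
      (if IsSupp (deadGraph G D) p.1 ∧ p.1.sources = {x} ∆ {y} then p.1.eweight K else 0) *
        (if p.2.sources = S then p.2.eweight K else 0) *
        ((if Vanishes D (p.1 + p.2) then (1 : ℝ≥0∞) else 0) * (connIn (deadGraph G D) x y).indicator 1 (p.1 + p.2)) := by
    unfold dsum
    rw [tsum_mul_tsum_eq_tsum_prod]
    refine tsum_congr fun p => ?_
    by_cases H : Vanishes D p.1 ∧ p.1.sources = {x} ∆ {y}
    · obtain ⟨hv1, hs1⟩ := H
      have hsupp : IsSupp (deadGraph G D) p.1 := (isSupp_deadGraph_iff D p.1).mpr hv1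
      have hind : (connIn (deadGraph G D) x y).indicator (1 : Current G → ℝ≥0∞) (p.1 + p.2) = 1 := by
        rw [Set.indicator_of_mem (add_mem_connIn_of_sources_eq (deadGraph G D) hsupp hs1 p.2)]; rfl
      rw [if_pos (show p.1.sources = {x} ∆ {y} ∧ Vanishes D p.1 from ⟨hs1, hv1⟩),
        if_pos (show IsSupp (deadGraph G D) p.1 ∧ p.1.sources = {x} ∆ {y} from ⟨hsupp, hs1⟩), hind, mul_one]
      by_cases hs2 : p.2.sources = S
      · by_cases hv2 : Vanishes D p.2
        · rw [if_pos (show p.2.sources = S ∧ Vanishes D p.2 from ⟨hs2, hv2⟩), if_pos hs2,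
            if_pos (vanishes_add.mpr ⟨hv1, hv2⟩), mul_one]
        · rw [if_neg (show ¬ (p.2.sources = S ∧ Vanishes D p.2) from fun h => hv2 h.2), if_pos hs2,
            if_neg (show ¬ Vanishes D (p.1 + p.2) from fun h => hv2 (vanishes_add.mp h).2), mul_zero, mul_zero]
      · rw [if_neg (show ¬ (p.2.sources = S ∧ Vanishes D p.2) from fun h => hs2 h.1), if_neg hs2,
          mul_zero, zero_mul]
    · have hA : ¬ (p.1.sources = {x} ∆ {y} ∧ Vanishes D p.1) := fun h => H ⟨h.2, h.1⟩
      have hB : ¬ (IsSupp (deadGraph G D) p.1 ∧ p.1.sources = {x} ∆ {y}) := fun h =>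
        H ⟨(isSupp_deadGraph_iff D p.1).mp h.1, h.2⟩
      rw [if_neg hA, if_neg hB, zero_mul, zero_mul, zero_mul]
  rw [hL, hsw, dsum, dsum, tsum_mul_tsum_eq_tsum_prod]
  refine ENNReal.tsum_le_tsum fun p => ?_
  by_cases H : Vanishes D p.1 ∧ p.1.sources = ∅ ∧ Vanishes D p.2 ∧ p.2.sources = S ∆ ({x} ∆ {y})
  · obtain ⟨hv1, hs1, hv2, hs2⟩ := H
    have hsupp : IsSupp (deadGraph G D) p.1 := (isSupp_deadGraph_iff D p.1).mpr hv1
    rw [if_pos (show IsSupp (deadGraph G D) p.1 ∧ p.1.sources = ∅ from ⟨hsupp, hs1⟩), if_pos hs2,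
      if_pos (vanishes_add.mpr ⟨hv1, hv2⟩), if_pos (show p.1.sources = ∅ ∧ Vanishes D p.1 from ⟨hs1, hv1⟩),
      if_pos (show p.2.sources = S ∆ ({x} ∆ {y}) ∧ Vanishes D p.2 from ⟨hs2, hv2⟩), one_mul]
    refine mul_le_of_le_one_right' ?_
    rw [Set.indicator_apply]; split_ifs <;> simp
  · -- one of the constraints fails: the left-hand side vanishes
    refine le_of_eq_of_le ?_ bot_le
    by_cases hv1 : Vanishes D p.1
    · by_cases hs1 : p.1.sources = ∅
      · by_cases hs2 : p.2.sources = S ∆ ({x} ∆ {y})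
        · have hv2 : ¬ Vanishes D p.2 := fun h => H ⟨hv1, hs1, h, hs2⟩
          rw [if_neg (show ¬ Vanishes D (p.1 + p.2) from fun h => hv2 (vanishes_add.mp h).2), zero_mul, mul_zero]
          rfl
        · rw [if_neg hs2, mul_zero, zero_mul]; rfl
      · rw [if_neg (show ¬ (IsSupp (deadGraph G D) p.1 ∧ p.1.sources = ∅) from fun h => hs1 h.2), zero_mul, zero_mul]
        rfl
    · rw [if_neg (show ¬ (IsSupp (deadGraph G D) p.1 ∧ p.1.sources = ∅) from fun h =>
        hv1 ((isSupp_deadGraph_iff D p.1).mp h.1)), zero_mul, zero_mul]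
      rfl

/-- `{u} ∆ {v} = {u, v}` for the endpoints of an edge. [folklore] -/
theorem symmDiff_singleton_eq_pair_of_edge (e₀ : G.edgeFinset) {u v : V} (huv : (e₀ : Sym2 V) = s(u, v)) :
    ({u} ∆ {v} : Finset V) = {u, v} := by
  have hne : u ≠ v := by
    have he := e₀.2
    rw [huv, SimpleGraph.mem_edgeFinset] at he
    exact G.ne_of_adj he
  ext w
  simp only [Finset.mem_symmDiff, Finset.mem_singleton, Finset.mem_insert]
  constructor
  · rintro (⟨h, -⟩ | ⟨h, -⟩) <;> simp [h]
  · rintro (rfl | rfl)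
    · exact Or.inl ⟨rfl, hne⟩
    · exact Or.inr ⟨rfl, fun h => hne h.symm⟩

/-! ### Monotonicity of the two-point ratio under dilution -/

/-- One more dead bond does not increase the two-point ratio:
`Z_{D+f}({u}∆{v}) · Z_D(∅) ≤ Z_D({u}∆{v}) · Z_{D+f}(∅)` for `f ∉ D`. [cite: AizenmanCMP1982, §9 Lemma 9.3] -/
theorem dsum_insert_pair_mul_le {β : ℝ} (hβ : 0 ≤ β) {D : Finset G.edgeFinset} {f : G.edgeFinset} (hf : f ∉ D)
    (u v : V) :
    dsum β (insert f D) ({u} ∆ {v}) * dsum β D ∅ ≤ dsum β D ({u} ∆ {v}) * dsum β (insert f D) ∅ := by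
  obtain ⟨⟨a, b⟩, hab⟩ := Quot.exists_rep (f : Sym2 V)
  have hab' : (f : Sym2 V) = s(a, b) := hab.symm
  rw [dsum_eq_cosh_mul_add_sinh_mul hβ hf hab' ∅, dsum_eq_cosh_mul_add_sinh_mul hβ hf hab' ({u} ∆ {v})]
  set P := dsum β (insert f D) with hP
  have hkey : P ({u} ∆ {v}) * P (∅ ∆ {a, b}) ≤ P (({u} ∆ {v}) ∆ {a, b}) * P ∅ := by
    rw [← symmDiff_singleton_eq_pair_of_edge f hab', show ((∅ : Finset V) ∆ ({a} ∆ {b})) = {a} ∆ {b} from bot_symmDiff _,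
      mul_comm (P (({u} ∆ {v}) ∆ ({a} ∆ {b})))]
    have := dsum_pair_mul_dsum_le hβ (insert f D) ({u} ∆ {v}) a b
    rw [mul_comm] at this
    exact this
  calc P ({u} ∆ {v}) * (ENNReal.ofReal (Real.cosh β) * P ∅ + ENNReal.ofReal (Real.sinh β) * P (∅ ∆ {a, b}))
      = ENNReal.ofReal (Real.cosh β) * (P ({u} ∆ {v}) * P ∅) +
          ENNReal.ofReal (Real.sinh β) * (P ({u} ∆ {v}) * P (∅ ∆ {a, b})) := by ring
    _ ≤ ENNReal.ofReal (Real.cosh β) * (P ({u} ∆ {v}) * P ∅) +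
          ENNReal.ofReal (Real.sinh β) * (P (({u} ∆ {v}) ∆ {a, b}) * P ∅) := by
        gcongr
    _ = (ENNReal.ofReal (Real.cosh β) * P ({u} ∆ {v}) +
          ENNReal.ofReal (Real.sinh β) * P (({u} ∆ {v}) ∆ {a, b})) * P ∅ := by ring

/-- **Monotonicity of the two-point ratio under dilution**: for `D ⊆ D'`,
`Z_{D'}({u}∆{v}) · Z_D(∅) ≤ Z_D({u}∆{v}) · Z_{D'}(∅)`, i.e. `⟨σ_uσ_v⟩_{G∖D'} ≤ ⟨σ_uσ_v⟩_{G∖D}`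
(Griffiths II). [cite: AizenmanCMP1982, §9 Lemma 9.3] -/
theorem dsum_pair_mul_dsum_empty_le {β : ℝ} (hβ : 0 ≤ β) {D D' : Finset G.edgeFinset} (h : D ⊆ D') (u v : V) :
    dsum β D' ({u} ∆ {v}) * dsum β D ∅ ≤ dsum β D ({u} ∆ {v}) * dsum β D' ∅ := by
  -- induction on the extra dead bonds
  suffices H : ∀ W : Finset G.edgeFinset,
      dsum β (D ∪ W) ({u} ∆ {v}) * dsum β D ∅ ≤ dsum β D ({u} ∆ {v}) * dsum β (D ∪ W) ∅ by
    have := H D'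
    rwa [Finset.union_eq_right.mpr h] at this
  intro W
  induction W using Finset.induction_on with
  | empty => rw [Finset.union_empty, mul_comm]
  | insert f W hfW ih =>
    by_cases hf : f ∈ D ∪ W
    · rwa [Finset.union_insert, Finset.insert_eq_of_mem hf]
    · rw [Finset.union_insert]
      have h1 := dsum_insert_pair_mul_le hβ hf u v
      -- chain the two inequalities and cancel `Z_{D ∪ W}(∅)`
      have hne0 := dsum_empty_ne_zero (G := G) β (D ∪ W)
      have hnet := dsum_ne_top (G := G) hβ (D ∪ W) ∅
      rw [← ENNReal.mul_le_mul_iff_left hne0 hnet]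
      calc dsum β (insert f (D ∪ W)) ({u} ∆ {v}) * dsum β D ∅ * dsum β (D ∪ W) ∅
          = (dsum β (insert f (D ∪ W)) ({u} ∆ {v}) * dsum β (D ∪ W) ∅) * dsum β D ∅ := by ring
        _ ≤ (dsum β (D ∪ W) ({u} ∆ {v}) * dsum β (insert f (D ∪ W)) ∅) * dsum β D ∅ := by gcongr
        _ = (dsum β (D ∪ W) ({u} ∆ {v}) * dsum β D ∅) * dsum β (insert f (D ∪ W)) ∅ := by ring
        _ ≤ (dsum β D ({u} ∆ {v}) * dsum β (D ∪ W) ∅) * dsum β (insert f (D ∪ W)) ∅ := by gcongr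
        _ = dsum β D ({u} ∆ {v}) * dsum β (insert f (D ∪ W)) ∅ * dsum β (D ∪ W) ∅ := by ring

/-! ### Supermodularity of the free energy in the bond set -/

/-- Removing one bond costs relatively less when more bonds are already removed:
`Z_{B+e}(∅) · Z_A(∅) ≥ Z_{A+e}(∅) · Z_B(∅)` for `A ⊆ B`, `e ∉ B`. [cite: AizenmanCMP1982, §9 Lemma 9.3] -/
theorem dsum_insert_empty_mul_ge {β : ℝ} (hβ : 0 ≤ β) {A B : Finset G.edgeFinset} (hAB : A ⊆ B) {e₀ : G.edgeFinset}
    (he₀ : e₀ ∉ B) :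
    dsum β (insert e₀ A) ∅ * dsum β B ∅ ≤ dsum β (insert e₀ B) ∅ * dsum β A ∅ := by
  obtain ⟨⟨a, b⟩, hab⟩ := Quot.exists_rep (e₀ : Sym2 V)
  have hab' : (e₀ : Sym2 V) = s(a, b) := hab.symm
  have heA : e₀ ∉ A := fun h => he₀ (hAB h)
  rw [dsum_eq_cosh_mul_add_sinh_mul hβ heA hab' ∅, dsum_eq_cosh_mul_add_sinh_mul hβ he₀ hab' ∅,
    show ((∅ : Finset V) ∆ {a, b}) = {a, b} from bot_symmDiff _, ← symmDiff_singleton_eq_pair_of_edge e₀ hab']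
  have hkey := dsum_pair_mul_dsum_empty_le hβ (Finset.insert_subset_insert e₀ hAB) a b
  calc dsum β (insert e₀ A) ∅ * (ENNReal.ofReal (Real.cosh β) * dsum β (insert e₀ B) ∅ +
        ENNReal.ofReal (Real.sinh β) * dsum β (insert e₀ B) ({a} ∆ {b}))
      = ENNReal.ofReal (Real.cosh β) * (dsum β (insert e₀ A) ∅ * dsum β (insert e₀ B) ∅) +
          ENNReal.ofReal (Real.sinh β) * (dsum β (insert e₀ B) ({a} ∆ {b}) * dsum β (insert e₀ A) ∅) := by ring
    _ ≤ ENNReal.ofReal (Real.cosh β) * (dsum β (insert e₀ A) ∅ * dsum β (insert e₀ B) ∅) +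
          ENNReal.ofReal (Real.sinh β) * (dsum β (insert e₀ A) ({a} ∆ {b}) * dsum β (insert e₀ B) ∅) := by
        gcongr
    _ = (ENNReal.ofReal (Real.cosh β) * dsum β (insert e₀ A) ∅ +
          ENNReal.ofReal (Real.sinh β) * dsum β (insert e₀ A) ({a} ∆ {b})) * dsum β (insert e₀ B) ∅ := by ring
    _ = dsum β (insert e₀ B) ∅ * (ENNReal.ofReal (Real.cosh β) * dsum β (insert e₀ A) ∅ +
          ENNReal.ofReal (Real.sinh β) * dsum β (insert e₀ A) ({a} ∆ {b})) := by ring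

/-- **Supermodularity of the free energy in the bond set** (`log Z` is supermodular in the set of
present bonds, `∂²/∂J_e∂J_f log Z = ⟨σ_e ; σ_f⟩ ≥ 0`): for all dead sets `D, U`,
`Z_{D ∪ U}(∅) · Z_∅(∅) ≥ Z_D(∅) · Z_U(∅)`. For the deletion factors `z(B) = Z_B(∅)/Z_∅(∅)` of Aizenman's
walk weights this is `z(B ∪ B') ≥ z(B) z(B')`, the monotonicity `ρ_{B'^c}(ω) ≥ ρ(ω)` of Aizenman 1982,
Lemma 9.3. [cite: AizenmanCMP1982, §9 Lemma 9.3] -/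
theorem dsum_empty_supermodular {β : ℝ} (hβ : 0 ≤ β) (D U : Finset G.edgeFinset) :
    dsum β D ∅ * dsum β U ∅ ≤ dsum β (D ∪ U) ∅ * dsum (G := G) β ∅ ∅ := by
  induction U using Finset.induction_on with
  | empty => rw [Finset.union_empty, mul_comm]
  | insert e₀ U heU ih =>
    by_cases heD : e₀ ∈ D
    · have h1 : D ∪ insert e₀ U = D ∪ U := by
        rw [Finset.union_insert, Finset.insert_eq_of_mem (Finset.mem_union_left U heD)]
      rw [h1]
      exact le_trans (by gcongr; exact dsum_anti β (Finset.subset_insert e₀ U) ∅) ih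
    · have he : e₀ ∉ D ∪ U := by rw [Finset.mem_union, not_or]; exact ⟨heD, heU⟩
      have h1 := dsum_insert_empty_mul_ge hβ (Finset.subset_union_right : U ⊆ D ∪ U) he
      have hne0 := dsum_empty_ne_zero (G := G) β U
      have hnet := dsum_ne_top (G := G) hβ U ∅
      rw [← ENNReal.mul_le_mul_iff_left hne0 hnet, Finset.union_insert]
      calc dsum β D ∅ * dsum β (insert e₀ U) ∅ * dsum β U ∅
          = dsum β D ∅ * dsum β U ∅ * dsum β (insert e₀ U) ∅ := by ring
        _ ≤ dsum β (D ∪ U) ∅ * dsum (G := G) β ∅ ∅ * dsum β (insert e₀ U) ∅ := by gcongr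
        _ = (dsum β (insert e₀ U) ∅ * dsum β (D ∪ U) ∅) * dsum (G := G) β ∅ ∅ := by ring
        _ ≤ (dsum β (insert e₀ (D ∪ U)) ∅ * dsum β U ∅) * dsum (G := G) β ∅ ∅ := by gcongr
        _ = dsum β (insert e₀ (D ∪ U)) ∅ * dsum (G := G) β ∅ ∅ * dsum β U ∅ := by ring

end Current

end Literature.Probability.LatticeModels

end
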